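import Mathlib
import Summits.MatrixMultiplication.MatrixMultiplication.Theses.FourierTwoFamiliesModP

/-!
# `PrimeTwoFamilies → cyclic ladders` — stub `cyclicLadder_of_primeTwoFamilies`
# (siege k9, Mathlib API route)

Crux `PrimeTwoFamilies` (stmt-MatrixMultiplication-14308, route `FourierTwoFamiliesModP`; CKSU 2005
Conj. 4.7 with prime cyclic hosts).  Line `Sketch` (Cruxes/PrimeTwoFamilies/Lines/Sketch.lean) reads the
crux through the CYCLIC LADDER CONJECTURE: for every `ε > 0` and arbitrarily large `m`, an ordered escape
ladder in `ℤ/m` — (i) every class `X c ⊕ Y c` direct; (ii) for classes `p < q`, every lower cross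
difference `y' - x'` (`x' ∈ X p`, `y' ∈ Y q`) avoids every diagonal difference `y - x` (`x ∈ X c`,
`y ∈ Y c`) — with `r ≥ m^{1/2-ε}` classes of co-volume `|X c| |Y c| ≥ m^{1-ε}`.

This file proves the registered stub `cyclicLadder_of_primeTwoFamilies` (crux ⇒ ladders) from Mathlib
and the route statement alone, organised so that NO case analysis on the sign of an exponent is needed:

* **slice reduction.**  The ladder conclusion is antitone in `ε` (for `m ≥ 1`, `t ↦ m^t` is monotone:
  `Real.rpow_le_rpow_of_exponent_le`), so it suffices to produce the ladder at the small slice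
  `η := min ε (1/4)`, where both exponents `1/2 - η ≥ 1/4` and `1 - η ≥ 3/4` are positive;
* **witness transfer.**  An SDPP witness `(A i, B i)_{i<n}` of the crux at `δ := η` in `ℤ/p` is a ladder
  in `ℤ/p` with `m := p`, `r := n`: clause (X) at `(i, j, k) = (p, c, q)` is exactly (ii);
* **packing by sumsets.**  Clause (W) says `(a, b) ↦ a + b` is injective on `A i ×ˢ B i`, i.e. the
  pointwise sumset has full size `#(A i + B i) = #A i * #B i` (`Finset.card_add_iff`, stated for any
  abelian group), whence `|A i| |B i| ≤ |ℤ/p| = p` (`Finset.card_le_univ`, `ZMod.card`) and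
  `m₀ < n ≤ n^{2-η} ≤ p`;
* **exponents.**  With positive exponents, `p ≤ n^{2+η}` gives `p^t ≤ n^{(2+η)t}` (`Real.rpow_le_rpow`,
  `Real.rpow_mul`), and `(2+η)(1/2-η) ≤ 1`, `(2+η)(1-η) ≤ 2-η`.

Other proofs of the same statement in the tree: `…Theorems.PrimeTwoFamilies.LadderLift.
cyclicLadder_of_primeTwoFamilies` (via `p^{1/(2+δ)} ≤ n`) and `…Theorems.PrimeTwoFamilies.SiegeK17.
cyclicLadder_of_primeTwoFamilies` (base monotonicity with sign case splits).
-/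

-- single-conjunct summit: the mandated namespace repeats `MatrixMultiplication` (summit = sub-problem).
set_option linter.dupNamespace false

namespace Summit.MatrixMultiplication.MatrixMultiplication.Theorems.PrimeTwoFamilies.SiegeK9

open Finset
open scoped Pointwise
open Summit.MatrixMultiplication.MatrixMultiplication.Theses

/-- **Direct pairs have full sumsets.**  In any abelian group, if `A ⊕ B` is direct (clause (W):
`(a - a') + (b - b') = 0` forces `a = a'`, `b = b'`), then the sum map is injective on `A ×ˢ B`,
i.e. the pointwise sumset has `#(A + B) = #A * #B` (`Finset.card_add_iff`). -/
theorem card_add_of_direct {G : Type*} [AddCommGroup G] [DecidableEq G] {A B : Finset G}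
    (hW : ∀ a ∈ A, ∀ a' ∈ A, ∀ b ∈ B, ∀ b' ∈ B, (a - a') + (b - b') = 0 → a = a' ∧ b = b') :
    (A + B).card = A.card * B.card := by
  refine Finset.card_add_iff.2 ?_
  rintro ⟨a, b⟩ ⟨ha, hb⟩ ⟨a', b'⟩ ⟨ha', hb'⟩ h
  have h' : a + b = a' + b' := h
  have h0 : (a - a') + (b - b') = 0 := by
    rw [show (a - a') + (b - b') = (a + b) - (a' + b') by abel, h', sub_self]
  obtain ⟨rfl, rfl⟩ := hW a ha a' ha' b hb b' hb' h0
  rfl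

/-- **Packing of a direct pair.**  In a finite abelian group a direct pair has
`#A * #B = #(A + B) ≤ |G|` (`card_add_of_direct`, `Finset.card_le_univ`); in `ZMod p` this is
`#A * #B ≤ p` (`ZMod.card`). -/
theorem card_mul_card_le_card_of_direct {G : Type*} [AddCommGroup G] [Fintype G] [DecidableEq G]
    {A B : Finset G}
    (hW : ∀ a ∈ A, ∀ a' ∈ A, ∀ b ∈ B, ∀ b' ∈ B, (a - a') + (b - b') = 0 → a = a' ∧ b = b') :
    A.card * B.card ≤ Fintype.card G :=
  (card_add_of_direct hW).symm.trans_le (card_le_univ _)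

/-- **Exponent bookkeeping at a small slice** (no sign cases): for `0 < η ≤ 1/4`, `1 ≤ n` and
`0 ≤ P ≤ n^{2+η}` one has `P^{1/2-η} ≤ n` and `P^{1-η} ≤ n^{2-η}`.  Both exponents are positive,
so `P^t ≤ (n^{2+η})^t = n^{(2+η)t}` (`Real.rpow_le_rpow`, `Real.rpow_mul`), and
`(2+η)(1/2-η) = 1 - 3η/2 - η² ≤ 1`, `(2+η)(1-η) = 2 - η - η² ≤ 2 - η`. -/
theorem exponents_small {η : ℝ} (hη : 0 < η) (hη4 : η ≤ 1 / 4) {P : ℝ} {n : ℕ} (hP : 0 ≤ P)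
    (hn : 1 ≤ n) (hPn : P ≤ (n : ℝ) ^ (2 + η)) :
    P ^ (1 / 2 - η) ≤ (n : ℝ) ∧ P ^ (1 - η) ≤ (n : ℝ) ^ (2 - η) := by
  have hn0 : (0 : ℝ) ≤ n := Nat.cast_nonneg n
  have hn1 : (1 : ℝ) ≤ n := by exact_mod_cast hn
  have key : ∀ t : ℝ, 0 ≤ t → P ^ t ≤ (n : ℝ) ^ ((2 + η) * t) := fun t ht =>
    (Real.rpow_le_rpow hP hPn ht).trans_eq (Real.rpow_mul hn0 _ _).symm
  refine ⟨(key _ (by linarith)).trans ?_, (key _ (by linarith)).trans ?_⟩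
  · calc (n : ℝ) ^ ((2 + η) * (1 / 2 - η)) ≤ (n : ℝ) ^ (1 : ℝ) :=
          Real.rpow_le_rpow_of_exponent_le hn1 (by nlinarith)
      _ = n := Real.rpow_one _
  · exact Real.rpow_le_rpow_of_exponent_le hn1 (by nlinarith)

/-- **Stub `cyclicLadder_of_primeTwoFamilies`** (crux ⇒ cyclic ladder conjecture, clauses inlined):
`PrimeTwoFamilies` gives, for every `ε > 0` and `m₀`, a modulus `m ≥ m₀` (a prime) and `r` classes
`(X c, Y c)` in `ZMod m` with (i) every class direct, (ii) lower cross differences (`p < q`) avoiding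
all diagonal differences, `m^{1/2-ε} ≤ r`, and co-volumes `m^{1-ε} ≤ |X c| |Y c|`.

Proof (Mathlib API route): reduce to the slice `η := min ε (1/4)` by monotonicity of `t ↦ p^t`
(`p ≥ 1`); an SDPP witness `(A i, B i)_{i<n}`, `n ≥ m₀ + 1`, of the crux at `δ := η` in `ℤ/p` is
the ladder with `m := p`, `r := n` — (ii) is clause (X) at `(i, j, k) = (p, c, q)`;
`m₀ < n ≤ n^{2-η} ≤ |A 0| |B 0| ≤ p` by `card_mul_card_le_card_of_direct` and `ZMod.card`; the
exponents are `exponents_small`. -/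
theorem cyclicLadder_of_primeTwoFamilies (hT : FourierTwoFamiliesModP.PrimeTwoFamilies) :
    ∀ ε : ℝ, 0 < ε → ∀ m₀ : ℕ, ∃ m ≥ m₀, ∃ r : ℕ, ∃ X Y : Fin r → Finset (ZMod m),
      ((∀ c : Fin r, ∀ x ∈ X c, ∀ x' ∈ X c, ∀ y ∈ Y c, ∀ y' ∈ Y c,
          (x - x') + (y - y') = 0 → x = x' ∧ y = y') ∧
        (∀ c p q : Fin r, p < q → ∀ x ∈ X c, ∀ y ∈ Y c, ∀ x' ∈ X p, ∀ y' ∈ Y q,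
          y - x ≠ y' - x')) ∧
      (m : ℝ) ^ (1 / 2 - ε) ≤ (r : ℝ) ∧
      ∀ c : Fin r, (m : ℝ) ^ (1 - ε) ≤ (((X c).card * (Y c).card : ℕ) : ℝ) := by
  intro ε hε m₀
  -- slice reduction: work at `η := min ε (1/4)`
  set η : ℝ := min ε (1 / 4) with hηdef
  have hη : 0 < η := lt_min hε (by norm_num)
  have hη4 : η ≤ 1 / 4 := min_le_right _ _
  have hηε : η ≤ ε := min_le_left _ _
  -- the SDPP witness of the crux at `δ := η`
  obtain ⟨n, hn, p, hp, A, B, hW, hX, hpn, hAB⟩ := hT η hη (m₀ + 1)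
  haveI : NeZero p := ⟨hp.ne_zero⟩
  have hn1 : 1 ≤ n := le_of_add_le_right hn
  have hn1' : (1 : ℝ) ≤ n := by exact_mod_cast hn1
  have hp1 : (1 : ℝ) ≤ p := by exact_mod_cast hp.one_lt.le
  obtain ⟨hr, hcov⟩ := exponents_small hη hη4 (Nat.cast_nonneg p) hn1 hpn
  -- `m₀ ≤ p`: `m₀ + 1 ≤ n ≤ n^{2-η} ≤ |A 0| |B 0| ≤ p`
  have hm₀ : m₀ ≤ p := by
    have h1 : (n : ℝ) ≤ (n : ℝ) ^ (2 - η) :=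
      (Real.rpow_one _).symm.trans_le (Real.rpow_le_rpow_of_exponent_le hn1' (by linarith))
    have h2 : (n : ℝ) ≤ p :=
      (h1.trans (hAB ⟨0, hn1⟩)).trans
        (by exact_mod_cast (card_mul_card_le_card_of_direct (hW ⟨0, hn1⟩)).trans_eq (ZMod.card p))
    have h3 : n ≤ p := by exact_mod_cast h2
    omega
  refine ⟨p, hm₀, n, A, B, ⟨hW, fun c p' q hpq x hx y hy x' hx' y' hy' heq => ?_⟩, ?_, fun c => ?_⟩
  · -- (ii) is clause (X) at `(i, j, k) = (p', c, q)`
    exact absurd (hX p' c q x' hx' x hx y hy y' hy' (by linear_combination heq)) (Fin.ne_of_lt hpq)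
  · -- `p^{1/2-ε} ≤ p^{1/2-η} ≤ n`
    exact (Real.rpow_le_rpow_of_exponent_le hp1 (by linarith)).trans hr
  · -- `p^{1-ε} ≤ p^{1-η} ≤ n^{2-η} ≤ |A c| |B c|`
    exact ((Real.rpow_le_rpow_of_exponent_le hp1 (by linarith)).trans hcov).trans (hAB c)

end Summit.MatrixMultiplication.MatrixMultiplication.Theorems.PrimeTwoFamilies.SiegeK9
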